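import Literature.NumberTheory.EllipticCurves.ModularJacobianGaloisCharpolyRel
import HarnessLib

/-!
# The [BLR] relations on `J₀(N)[𝔪]` from Eichler–Shimura + Chebotarev — any residue characteristic `ℓ`

`ℓ`-generic twin of `exists_charpolyRel_torsionBySet_of_galoisData` (`ModularJacobianGaloisCharpolyRel.lean`, the
case `ℓ = 2` feeding Buzzard 2000 Prop. 2.4). For a maximal ideal `𝔪 ∋ ℓ` of `𝕋_ℤ` (any `ℓ ≠ 0`, any level `N`),
a `ℚ`-structure datum `D : ModularJacobianGaloisData N ι` whose Galois action satisfies the Eichler–Shimura relation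
on `J₀(N)[ℓ]` at arithmetic Frobenius elements above `p ∤ Nℓ` (as supplied by the cited fact
`nonempty_modularJacobianGaloisData_eichlerShimura`), and `ρ : Γ_ℚ → GL₂(k)` (`k ⊇ 𝕋/𝔪` discrete) with
`charpoly ρ(Frob_p) = X² − ι(T_p) X + p` for `p ∤ Nℓ` (the hypothesis shape of the tree's `wiles1995_multiplicityOne`,
Darmon–Diamond–Taylor Thm. 4.26, and of `buzzard2000_multiplicityOne_gamma0`): the `𝕋/𝔪`-linear Galois
representation `σ` on `J0 N[𝔪]` satisfies `σ(g)² − t(g)σ(g) + n(g) = 0` with `ι(t g) = tr ρ(g)`, `ι(n g) = det ρ(g)`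
for EVERY `g ∈ Γ_ℚ` — the hypothesis of Boston–Lenstra–Ribet ("by the argument in [Maz1] prop. II.14.2 or by the main
result of [BLR]", Darmon–Diamond–Taylor §4.5 p. 135). Proof identical to the `ℓ = 2` case: joint open normal kernel
`ker σ ∩ ker ρ` + the tree's proved Chebotarev `exists_isArithFrobAt_mul_inv_mem_not_mem`.

HONESTY: a Galois-side lemma; no multiplicity-one statement and no summit statement is proved here.
-/

noncomputable section

open scoped MatrixGroups ModularForm NumberField

open CongruenceSubgroup Polynomial IsDedekindDomain

namespace Literature.NumberTheory.EllipticCurves.ModularForms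

open GaloisRepresentations Rat.HeightOneSpectrum

variable (N : ℕ) [NeZero N]

set_option maxHeartbeats 400000 in
/-- **Eichler–Shimura + Chebotarev ⇒ the [BLR] relations on `J₀(N)[𝔪]`, any residue characteristic**
(the `ℓ`-generic form of `exists_charpolyRel_torsionBySet_of_galoisData`, which is the case `ℓ = 2`; for odd `ℓ` this is
the Galois input of Darmon–Diamond–Taylor §4.5 / Wiles 1995 Thm. 2.1, tree fact `wiles1995_multiplicityOne`) (Mazur 1977 II.14.2;
Buzzard 2000, proof of Prop. 2.4; Darmon–Diamond–Taylor §4.5 p. 135). Hypotheses: `𝔪 ∋ ℓ ≠ 0` an ideal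
of `𝕋_ℤ`, any level `N`; `k ⊇ 𝕋/𝔪` via `ι`, with the discrete topology; `ρ : Γ_ℚ → GL₂(k)`
continuous, unramified at `v ∤ Nℓ` with `charpoly ρ(Frob_v) = X² - ι(T_p) X + p` (`ρ ≅ ρ_𝔪`, the
hypothesis of `buzzard2000_multiplicityOne_gamma0`); a Galois datum `D` on `J0.tors N` satisfying
the Eichler–Shimura relation `φ² - T_p φ + p = 0` on the `ℓ`-torsion for every arithmetic Frobenius
`φ` above `p ∤ Nℓ` (`hD`; Darmon–Diamond–Taylor Thm. 1.29). Conclusion: a `𝕋/𝔪`-linear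
representation `σ` of `Γ_ℚ` on `J0 N[𝔪]` agreeing with `D.galAct`, and `t, n : Γ_ℚ → 𝕋/𝔪` with
`ι(t g) = tr ρ(g)`, `ι(n g) = det ρ(g)`, `σ(g)² - t(g) σ(g) + n(g) = 0` for ALL `g` — the
hypothesis of Boston–Lenstra–Ribet (tree: `CharpolyQuotientRankTwo*`). Chebotarev enters through
the tree's proved `exists_isArithFrobAt_mul_inv_mem_not_mem` applied to the open normal subgroup
`ker σ ∩ ker ρ`. [cite: DarmonDiamondTaylor1995, Thm. 1.29 (p. 37) and §4.5 (p. 135)]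
[cite: Buzzard2000LevelLoweringModTwo, proof of Prop. 2.4 (p. 101)] -/
theorem exists_charpolyRel_torsionBySet_of_galoisData_prime (𝔪 : Ideal (HeckeRing0 N 2))
    {ℓ : ℕ} (hℓ : ℓ ≠ 0) (hℓ𝔪 : (ℓ : HeckeRing0 N 2) ∈ 𝔪)
    {k : Type*} [Field k] [TopologicalSpace k] [DiscreteTopology k]
    (ι : HeckeRing0 N 2 ⧸ 𝔪 →+* k) (ρ : ModPGaloisRep ℚ k 2)
    (hES : ∀ v : HeightOneSpectrum (𝓞 ℚ), ¬ ((primesEquiv v : Nat.Primes) : ℕ) ∣ N * ℓ →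
      ρ.IsUnramifiedAt v ∧
        ρ.HasFrobCharpolyAt v
          (X ^ 2
            - C (ι (Ideal.Quotient.mk 𝔪 (HeckeRing0.T N 2
                ((primesEquiv v : Nat.Primes) : ℕ) (primesEquiv v : Nat.Primes).2))) * X
            + C (((primesEquiv v : Nat.Primes) : ℕ) : k)))
    {ιℂ : AlgebraicClosure ℚ →+* ℂ} (D : ModularJacobianGaloisData N ιℂ)
    (hD : ∀ v : HeightOneSpectrum (𝓞 ℚ), ¬ ((primesEquiv v : Nat.Primes) : ℕ) ∣ N * ℓ →
      ∀ 𝔓 ∈ v.primesAbove, ∀ φ : Field.absoluteGaloisGroup ℚ, IsArithFrobAt (𝓞 ℚ) φ 𝔓 →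
      ∀ x : J0.tors N, (ℓ : HeckeRing0 N 2) • x = 0 →
        D.galAct φ (D.galAct φ x)
          - (HeckeRing0.T N 2 ((primesEquiv v : Nat.Primes) : ℕ) (primesEquiv v : Nat.Primes).2)
              • D.galAct φ x
          + (((primesEquiv v : Nat.Primes) : ℕ) : HeckeRing0 N 2) • x = 0) :
    ∃ (σ : Representation (HeckeRing0 N 2 ⧸ 𝔪) (Field.absoluteGaloisGroup ℚ)
        (Submodule.torsionBySet (HeckeRing0 N 2) (J0 N) 𝔪))
      (t n : Field.absoluteGaloisGroup ℚ → HeckeRing0 N 2 ⧸ 𝔪),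
      (∀ (g : Field.absoluteGaloisGroup ℚ) (x : Submodule.torsionBySet (HeckeRing0 N 2) (J0 N) 𝔪)
        (x' : J0.tors N), (x' : J0 N) = x →
        ((σ g x : Submodule.torsionBySet (HeckeRing0 N 2) (J0 N) 𝔪) : J0 N)
          = ((D.galAct g x' : J0.tors N) : J0 N)) ∧
      ∀ g : Field.absoluteGaloisGroup ℚ,
        ι (t g) = ((ρ g : GL (Fin 2) k) : Matrix (Fin 2) (Fin 2) k).trace ∧
        ι (n g) = ((ρ g : GL (Fin 2) k) : Matrix (Fin 2) (Fin 2) k).det ∧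
        σ g * σ g - t g • σ g + n g •
          (1 : Module.End (HeckeRing0 N 2 ⧸ 𝔪)
            (Submodule.torsionBySet (HeckeRing0 N 2) (J0 N) 𝔪)) = 0 := by
  classical
  set V := Submodule.torsionBySet (HeckeRing0 N 2) (J0 N) 𝔪 with hV
  have hVt : ∀ x : V, (x : J0 N) ∈ J0.tors N := fun x =>
    J0.torsionBy_le_tors N hℓ (J0.torsionBySet_le_torsionBy N hℓ𝔪 x.2)
  obtain ⟨σ, hσ⟩ := exists_representation_torsionBySet_of_galoisData N 𝔪 hℓ hℓ𝔪 D
  -- the joint kernel `K = ker σ ∩ ker ρ`, an open normal subgroup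
  set K : Subgroup (Field.absoluteGaloisGroup ℚ) := (MonoidHom.prod σ ρ.toMonoidHom).ker with hK
  haveI : K.Normal := MonoidHom.normal_ker _
  have hρker : IsOpen ((ρ.toMonoidHom.ker : Subgroup (Field.absoluteGaloisGroup ℚ)) :
      Set (Field.absoluteGaloisGroup ℚ)) := by
    have e : ((ρ.toMonoidHom.ker : Subgroup (Field.absoluteGaloisGroup ℚ)) :
        Set (Field.absoluteGaloisGroup ℚ)) = ρ ⁻¹' {1} := by
      ext g
      simp [MonoidHom.mem_ker]
    rw [e]
    exact (isOpen_discrete _).preimage (map_continuous ρ)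
  have hKopen : IsOpen (K : Set (Field.absoluteGaloisGroup ℚ)) := by
    have e : (K : Set (Field.absoluteGaloisGroup ℚ)) =
        ((MonoidHom.ker σ : Subgroup (Field.absoluteGaloisGroup ℚ)) :
            Set (Field.absoluteGaloisGroup ℚ)) ∩
          ((ρ.toMonoidHom.ker : Subgroup (Field.absoluteGaloisGroup ℚ)) :
            Set (Field.absoluteGaloisGroup ℚ)) := by
      ext g
      simp [hK, MonoidHom.mem_ker, Prod.ext_iff]
    rw [e]
    exact (isOpen_ker_of_agree_galAct N 𝔪 hℓ hℓ𝔪 D σ hσ).inter hρker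
  -- the finite set of places dividing `Nℓ`
  have hS : {v : HeightOneSpectrum (𝓞 ℚ) | ((primesEquiv v : Nat.Primes) : ℕ) ∣ N * ℓ}.Finite := by
    have hfin : {q : Nat.Primes | (q : ℕ) ∣ N * ℓ}.Finite := by
      refine ((N * ℓ).primeFactors.finite_toSet.preimage
        Nat.Primes.coe_nat_injective.injOn).subset ?_
      intro q hq
      simp only [Set.mem_preimage, Finset.mem_coe, Nat.mem_primeFactors]
      exact ⟨q.2, hq, mul_ne_zero (NeZero.ne N) hℓ⟩
    have e : {v : HeightOneSpectrum (𝓞 ℚ) | ((primesEquiv v : Nat.Primes) : ℕ) ∣ N * ℓ} =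
        primesEquiv ⁻¹' {q : Nat.Primes | (q : ℕ) ∣ N * ℓ} := rfl
    rw [e]
    exact Set.Finite.preimage primesEquiv.injective.injOn hfin
  -- for each `g`, a Frobenius in the coset `g K` outside `Nℓ`
  have main : ∀ g : Field.absoluteGaloisGroup ℚ, ∃ t n : HeckeRing0 N 2 ⧸ 𝔪,
      ι t = ((ρ g : GL (Fin 2) k) : Matrix (Fin 2) (Fin 2) k).trace ∧
      ι n = ((ρ g : GL (Fin 2) k) : Matrix (Fin 2) (Fin 2) k).det ∧
      σ g * σ g - t • σ g + n • (1 : Module.End (HeckeRing0 N 2 ⧸ 𝔪) V) = 0 := by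
    intro g
    obtain ⟨v, hvS, -, 𝔓, h𝔓, φ, hφ, hmem⟩ :=
      exists_isArithFrobAt_mul_inv_mem_not_mem ℚ K hKopen g _ hS
    have hker : σ (φ * g⁻¹) = 1 ∧ ρ.toMonoidHom (φ * g⁻¹) = 1 := by
      have h := (MonoidHom.mem_ker).1 hmem
      rwa [MonoidHom.prod_apply, Prod.mk_eq_one] at h
    have hσeq : σ φ = σ g := by
      have h1 : σ (φ * g⁻¹) * σ g = σ g := by rw [hker.1, one_mul]
      rwa [← map_mul, inv_mul_cancel_right] at h1
    have hρeq : ρ φ = ρ g := by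
      have h1 := hker.2
      rw [map_mul, map_inv, mul_inv_eq_one] at h1
      exact h1
    set p : Nat.Primes := primesEquiv v with hp
    -- Eichler–Shimura on `V` at `φ`
    have hESV : σ φ * σ φ - (Ideal.Quotient.mk 𝔪 (HeckeRing0.T N 2 (p : ℕ) p.2)) • σ φ
        + (Ideal.Quotient.mk 𝔪 ((p : ℕ) : HeckeRing0 N 2)) •
          (1 : Module.End (HeckeRing0 N 2 ⧸ 𝔪) V) = 0 := by
      apply LinearMap.ext
      intro x
      apply Subtype.ext
      have hxℓ : (ℓ : HeckeRing0 N 2) • (⟨x, hVt x⟩ : J0.tors N) = 0 :=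
        Subtype.ext ((Submodule.mem_torsionBySet_iff _ _).mp x.2 ⟨(ℓ : HeckeRing0 N 2), hℓ𝔪⟩)
      have hE := congrArg (fun y : J0.tors N => (y : J0 N))
        (hD v hvS 𝔓 h𝔓 φ hφ ⟨x, hVt x⟩ hxℓ)
      have e1 : ((σ φ x : V) : J0 N) = (D.galAct φ ⟨x, hVt x⟩ : J0 N) := hσ φ x ⟨x, hVt x⟩ rfl
      have e2 : ((σ φ (σ φ x) : V) : J0 N) = (D.galAct φ (D.galAct φ ⟨x, hVt x⟩) : J0 N) :=
        hσ φ (σ φ x) (D.galAct φ ⟨x, hVt x⟩) e1.symm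
      simp only [Submodule.coe_add, Submodule.coe_sub, Submodule.coe_smul, LinearMap.add_apply,
        LinearMap.sub_apply, LinearMap.smul_apply, Module.End.mul_apply, Module.End.one_apply,
        LinearMap.zero_apply, Submodule.coe_zero, Submodule.torsionBySet.mk_smul] at hE ⊢
      rw [e2, e1]
      exact hE
    -- the characteristic polynomial of `ρ φ`
    obtain ⟨-, hch⟩ := hES v hvS
    have hP : ((ρ φ : GL (Fin 2) k) : Matrix (Fin 2) (Fin 2) k).charpoly =
        X ^ 2 - C (ι (Ideal.Quotient.mk 𝔪 (HeckeRing0.T N 2 (p : ℕ) p.2))) * X + C ((p : ℕ) : k) :=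
      hch 𝔓 h𝔓 φ hφ
    have htr : ((ρ φ : GL (Fin 2) k) : Matrix (Fin 2) (Fin 2) k).trace =
        ι (Ideal.Quotient.mk 𝔪 (HeckeRing0.T N 2 (p : ℕ) p.2)) := by
      rw [Matrix.trace_eq_neg_charpoly_coeff, hP]
      simp
    have hdet : ((ρ φ : GL (Fin 2) k) : Matrix (Fin 2) (Fin 2) k).det = ((p : ℕ) : k) := by
      rw [Matrix.det_eq_sign_charpoly_coeff, hP]
      simp
    refine ⟨Ideal.Quotient.mk 𝔪 (HeckeRing0.T N 2 (p : ℕ) p.2),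
      Ideal.Quotient.mk 𝔪 ((p : ℕ) : HeckeRing0 N 2), ?_, ?_, ?_⟩
    · rw [← hρeq]
      exact htr.symm
    · have e : ι (Ideal.Quotient.mk 𝔪 ((p : ℕ) : HeckeRing0 N 2)) = ((p : ℕ) : k) := by
        rw [map_natCast, map_natCast]
      rw [e, ← hρeq]
      exact hdet.symm
    · -- transport the relation from `φ` to `g` pointwise (`σ g = σ φ`)
      apply LinearMap.ext
      intro x
      have ex : σ g x = σ φ x := (DFunLike.congr_fun hσeq x).symm
      have ex2 : σ g (σ φ x) = σ φ (σ φ x) := (DFunLike.congr_fun hσeq (σ φ x)).symm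
      have hE := DFunLike.congr_fun hESV x
      simp only [LinearMap.add_apply, LinearMap.sub_apply, LinearMap.smul_apply, Module.End.mul_apply,
        Module.End.one_apply, LinearMap.zero_apply] at hE ⊢
      simp only [ex, ex2]
      exact hE
  choose t n ht hn hrel using main
  exact ⟨σ, t, n, hσ, fun g => ⟨ht g, hn g, hrel g⟩⟩


end Literature.NumberTheory.EllipticCurves.ModularForms

end
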